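import Literature.Probability.LatticeModels.LatticeWalkWinding
import Literature.Probability.LatticeModels.WeakBeurlingEstimate
import Literature.Probability.Percolation.AnnulusCircuitsProofs
import HarnessLib

/-!
# Winding calculus of closed lattice walks (line `symplectic-fermion-anchor`, crux
`SAWLoopFugacityFlow.AvoidanceLimit`, stmt-CriticalPhenomena-10649)

The lattice calculus of the combinatorial winding number
`Literature.Probability.Percolation.walkWinding p u` of a CLOSED lattice walk `p` of `ℤ²` about the
face centre `u + (½, ½)` (the signed number of vertical steps of `p` crossing the horizontal
half-line to the right of `u + (½, ½)`; `Literature/Probability/Percolation/PlanarDuality.lean`,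
H. Kesten, *Percolation theory for mathematicians* (1982), §2.2), as used by the shield lemma of
the line (the region `{winding ≠ 0}` of a closed walk as a certified region):

* `walkWinding_eq_of_adj_of_closed` — the winding number of a closed walk is constant across a
  lattice step between two sites off the walk (the separating edge has an endpoint off the walk;
  the tree's `WeakBeurling.walkWinding_closed_eq_of_stepKind` in the `Adj` form);
* `walkWinding_faces_eq_of_not_mem_support` — the four faces around a site off the walk carry the
  same winding number (the edges between them have that site as an endpoint; for a closed walk
  there is no boundary term in the edge calculus across a horizontal edge,
  `walkWinding_eq_walkWinding_up_of_closed` of `Percolation/AnnulusCircuitsProofs.lean`);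
* `abs_sum_map_eq_one_of_count_eq_one`, `abs_walkWinding_sub_right_of_count_eq_one`,
  `abs_walkWinding_sub_up_of_count_eq_one` — across an edge used exactly once by a closed walk
  the winding number jumps by `±1`: in the edge calculus
  (`walkWinding_sub_walkWinding_right` / `_up`) exactly one dart contributes, and it contributes
  `±1` (`vCross` / `hCross`).

Everything is proved; no definitions. The jump lemmas adapt the `Nodup` versions
`walkWinding_sub_eq_of_vertical_mem` / `walkWinding_sub_eq_of_horizontal_mem` of
`Literature/Probability/LatticeModels/RandomClusterBoxDuality.lean` to an edge of multiplicity
one. Source: H. Kesten, *Percolation theory for mathematicians*,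
Birkhäuser (1982), §2.2 [Kesten1982].
-/

noncomputable section

open scoped BigOperators Classical
open Set Complex SimpleGraph
open Literature.Topology.PlaneTopology
open Literature.Probability.Percolation (walkWinding vCross hCross stepKind_of_adj
  vCross_eq_zero_of_ne hCross_eq_zero_of_ne walkWinding_sub_walkWinding_right
  walkWinding_sub_walkWinding_up walkWinding_eq_walkWinding_right walkWinding_eq_walkWinding_up_of_closed)
open Literature.Probability.LatticeModels

namespace Summit.CriticalPhenomena.SAWScalingLimit.Theorems.AvoidanceLimit.Anchor

/-! ### Constancy off the walk -/

/-- An edge with an endpoint off the walk is not an edge of the walk. [folklore] -/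
theorem sym2_not_mem_edges_of_not_mem_support {a b : Site 2} {p : (zdGraph 2).Walk a b} {x y : Site 2}
    (hx : x ∉ p.support) : s(x, y) ∉ p.edges ∧ s(y, x) ∉ p.edges :=
  ⟨fun he => hx (Walk.fst_mem_support_of_mem_edges p he),
    fun he => hx (Walk.snd_mem_support_of_mem_edges p he)⟩

/-- **The winding number of a closed lattice walk is constant across sites off the walk**: if
`v`, `w` are lattice neighbours not visited by the closed walk `p`, then `p` winds equally about
the face centres `v + (½, ½)` and `w + (½, ½)`. The two faces are separated by the edge
`{w, w + e₁}` (step to the right), `{v, v + e₁}` (left), `{w, w + e₀}` (up) or `{v, v + e₀}`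
(down), which is not an edge of `p` since `v, w ∉ p.support`, and for a closed walk the edge
calculus across it has no boundary term (the tree's `WeakBeurling.walkWinding_closed_eq_of_stepKind`,
with `StepKind` supplied by `stepKind_of_adj`). [folklore] -/
theorem walkWinding_eq_of_adj_of_closed :
    ∀ {a : Site 2} (p : (zdGraph 2).Walk a a) (v w : Site 2), (zdGraph 2).Adj v w →
      v ∉ p.support → w ∉ p.support → walkWinding p v = walkWinding p w := by
  intro a p v w hvw hv hw
  exact WeakBeurling.walkWinding_closed_eq_of_stepKind (stepKind_of_adj hvw) hv hw

/-- **The four faces around a site off a closed walk carry the same winding number.** For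
`v ∉ p.support`, the faces with lower-left corners `v - e₀`, `v - e₁`, `v - e₀ - e₁` and `v` are
pairwise separated by the edges `{v, v + e₁}`, `{v, v + e₀}` and `{v - e₀, v}`, all of which have
the endpoint `v` off the walk and so are not edges of `p`; the edge calculus
(`walkWinding_eq_walkWinding_right`, and `walkWinding_eq_walkWinding_up_of_closed`: for a closed
walk there is no boundary term across a horizontal edge) gives the three equalities. [folklore] -/
theorem walkWinding_faces_eq_of_not_mem_support :
    ∀ {a : Site 2} (p : (zdGraph 2).Walk a a) (v : Site 2), v ∉ p.support →
      walkWinding p (v - Pi.single 0 1) = walkWinding p v ∧ walkWinding p (v - Pi.single 1 1) = walkWinding p v ∧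
        walkWinding p (v - Pi.single 0 1 - Pi.single 1 1) = walkWinding p v := by
  intro a p v hv
  -- face `v - e₀` versus face `v`: separated by the vertical edge `{v, v + e₁}`
  have h₁ : walkWinding p (v - Pi.single 0 1) = walkWinding p v := by
    have key := walkWinding_eq_walkWinding_right (p := p) (u := v - Pi.single 0 1)
      (by rw [sub_add_cancel]; exact (sym2_not_mem_edges_of_not_mem_support hv).1)
    rwa [sub_add_cancel] at key
  refine ⟨h₁, ?_, ?_⟩
  · -- face `v - e₁` versus face `v`: separated by the horizontal edge `{v, v + e₀}`
    have key := walkWinding_eq_walkWinding_up_of_closed p (u := v - Pi.single 1 1)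
      (by rw [sub_add_cancel]; exact (sym2_not_mem_edges_of_not_mem_support hv).1)
    rwa [sub_add_cancel] at key
  · -- face `v - e₀ - e₁` versus face `v - e₀`: separated by the horizontal edge `{v - e₀, v}`
    have key := walkWinding_eq_walkWinding_up_of_closed p (u := v - Pi.single 0 1 - Pi.single 1 1)
      (by rw [sub_add_cancel, sub_add_cancel]; exact (sym2_not_mem_edges_of_not_mem_support hv).2)
    rw [sub_add_cancel] at key
    exact key.trans h₁

/-! ### The jump across an edge used exactly once -/

/-- **One nonzero term.** If `g x = e` for exactly one entry `x` of the list `l` (counted with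
multiplicity), `f` vanishes at the entries with `g x ≠ e` and has absolute value `1` at those with
`g x = e`, then `|∑_{x ∈ l} f x| = 1`. [folklore] -/
theorem abs_sum_map_eq_one_of_count_eq_one {α β : Type*} [DecidableEq β] (g : α → β) (f : α → ℤ) (e : β) :
    ∀ l : List α, (∀ x ∈ l, g x ≠ e → f x = 0) → (∀ x ∈ l, g x = e → |f x| = 1) →
      (l.map g).count e = 1 → |(l.map f).sum| = 1 := by
  intro l
  induction l with
  | nil => intro _ _ hc; simp at hc
  | cons x l ih =>
    intro h0 h1 hc
    rw [List.map_cons, List.sum_cons]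
    by_cases hx : g x = e
    · -- the head is the unique entry over `e`: the tail contributes nothing
      rw [List.map_cons, hx, List.count_cons_self, Nat.add_eq_right, List.count_eq_zero] at hc
      have htail : (l.map f).sum = 0 := by
        refine List.sum_eq_zero fun t ht => ?_
        obtain ⟨y, hy, rfl⟩ := List.mem_map.1 ht
        exact h0 y (List.mem_cons_of_mem x hy) fun hye => hc (List.mem_map.2 ⟨y, hy, hye⟩)
      rw [htail, add_zero]
      exact h1 x List.mem_cons_self hx
    · rw [List.map_cons, List.count_cons_of_ne hx] at hc
      rw [h0 x List.mem_cons_self hx, zero_add]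
      exact ih (fun y hy => h0 y (List.mem_cons_of_mem x hy)) (fun y hy => h1 y (List.mem_cons_of_mem x hy)) hc

/-- A dart along the vertical edge `{u + e₀, u + e₀ + e₁}` traverses it upwards (`vCross = 1`) or
downwards (`vCross = -1`). [folklore] -/
theorem abs_vCross_eq_one_of_edge_eq {u : Site 2} {d : (zdGraph 2).Dart}
    (hd : d.edge = s(u + Pi.single 0 1, u + Pi.single 0 1 + Pi.single 1 1)) : |vCross u d.fst d.snd| = 1 := by
  -- adapted from Literature/Probability/LatticeModels/RandomClusterBoxDuality.lean (`walkWinding_sub_eq_of_vertical_mem`)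
  have hd2 : s(d.fst, d.snd) = s(u + Pi.single 0 1, u + Pi.single 0 1 + Pi.single 1 1) := hd
  rcases Sym2.eq_iff.1 hd2 with ⟨h1, h2⟩ | ⟨h1, h2⟩
  · unfold vCross
    rw [if_pos, if_neg] <;> simp [h1, h2]
  · unfold vCross
    rw [if_neg, if_pos] <;> simp [h1, h2]

/-- A dart along the horizontal edge `{u + e₁, u + e₁ + e₀}` traverses it rightwards
(`hCross = 1`) or leftwards (`hCross = -1`). [folklore] -/
theorem abs_hCross_eq_one_of_edge_eq {u : Site 2} {d : (zdGraph 2).Dart}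
    (hd : d.edge = s(u + Pi.single 1 1, u + Pi.single 1 1 + Pi.single 0 1)) : |hCross u d.fst d.snd| = 1 := by
  -- adapted from Literature/Probability/LatticeModels/RandomClusterBoxDuality.lean (`walkWinding_sub_eq_of_horizontal_mem`)
  have hd2 : s(d.fst, d.snd) = s(u + Pi.single 1 1, u + Pi.single 1 1 + Pi.single 0 1) := hd
  rcases Sym2.eq_iff.1 hd2 with ⟨h1, h2⟩ | ⟨h1, h2⟩
  · unfold hCross
    rw [if_pos, if_neg] <;> simp [h1, h2]
  · unfold hCross
    rw [if_neg, if_pos] <;> simp [h1, h2]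

/-- **Jump across a vertical edge used exactly once.** If the closed lattice walk `p` uses the
vertical edge `{u + e₀, u + e₀ + e₁}` exactly once (counted with multiplicity in `p.edges`), then
its winding numbers about the faces `u` (left of the edge) and `u + e₀` (right of it) differ by
exactly one in absolute value: by `walkWinding_sub_walkWinding_right` the difference is the signed
number of traversals `∑_d vCross u d` over the darts of `p`, in which exactly one dart lies over
the edge and contributes `±1` (`abs_vCross_eq_one_of_edge_eq`), the others `0`
(`vCross_eq_zero_of_ne`). [folklore] -/
theorem abs_walkWinding_sub_right_of_count_eq_one :
    ∀ {a : Site 2} (p : (zdGraph 2).Walk a a) (u : Site 2),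
      p.edges.count s(u + Pi.single 0 1, u + Pi.single 0 1 + Pi.single 1 1) = 1 →
        |walkWinding p u - walkWinding p (u + Pi.single 0 1)| = 1 := by
  intro a p u hc
  rw [walkWinding_sub_walkWinding_right]
  unfold Walk.edges at hc
  exact abs_sum_map_eq_one_of_count_eq_one Dart.edge (fun d => vCross u d.fst d.snd) _ p.darts
    (fun d _ hne => vCross_eq_zero_of_ne hne) (fun d _ hde => abs_vCross_eq_one_of_edge_eq hde) hc

/-- **Jump across a horizontal edge used exactly once.** If the closed lattice walk `p` uses the
horizontal edge `{u + e₁, u + e₁ + e₀}` exactly once (counted with multiplicity in `p.edges`),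
then its winding numbers about the faces `u` (below the edge) and `u + e₁` (above it) differ by
exactly one in absolute value: for a closed walk the boundary term of
`walkWinding_sub_walkWinding_up` vanishes and the difference is minus the signed number of
traversals `∑_d hCross u d`, in which exactly one dart lies over the edge and contributes `±1`
(`abs_hCross_eq_one_of_edge_eq`), the others `0` (`hCross_eq_zero_of_ne`). [folklore] -/
theorem abs_walkWinding_sub_up_of_count_eq_one :
    ∀ {a : Site 2} (p : (zdGraph 2).Walk a a) (u : Site 2),
      p.edges.count s(u + Pi.single 1 1, u + Pi.single 1 1 + Pi.single 0 1) = 1 →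
        |walkWinding p u - walkWinding p (u + Pi.single 1 1)| = 1 := by
  intro a p u hc
  have hsub := walkWinding_sub_walkWinding_up p u
  rw [sub_self, neg_zero, zero_sub] at hsub
  rw [hsub, abs_neg]
  unfold Walk.edges at hc
  exact abs_sum_map_eq_one_of_count_eq_one Dart.edge (fun d => hCross u d.fst d.snd) _ p.darts
    (fun d _ hne => hCross_eq_zero_of_ne hne) (fun d _ hde => abs_hCross_eq_one_of_edge_eq hde) hc

end Summit.CriticalPhenomena.SAWScalingLimit.Theorems.AvoidanceLimit.Anchor

end
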